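import Summits.Ventures.WeilGRH.BaseRungEvenTransfer
import Literature.NumberTheory.LFunctions.WeilFirstPrimePositivityC
import HarnessLib

/-!
# GRH arm (rh-explicit, venture WeilGRH): transfer of the `ζ` rung `(log 3)/2` to even characters trivial at `2`

If `χ` is an even Dirichlet character mod `q ≥ 12` with `χ(2) = 1`, then Weil positivity for
`L(s, χ)` holds on `[-(log 3)/2, (log 3)/2]` — the base rung of the `ζ` support-extension ladder
(one prime power, `n = 2`, inside the window):
`WeilPositivityOnChar χ ((log 3)/2)`.

## Proof (transfer, no new analysis)

With `k = g ⋆ g̃` supported in `[-log 3, log 3]`, the prime terms of `ζ` and of `χ` AGREE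
(`weilPrimeTermChar_eq_weilPrimeTerm_of_trivial_at_two`: only `n = 2` contributes, with
`χ(2) = 1`; `n ≥ 3` is killed by the support, `k(± log n) = 0`), so
`Q_χ(g) = Q_ζ(g) - [ĝ(0)conj ĝ(1) + ĝ(1)conj ĝ(0)] + (log q) ‖g‖₂²` exactly. The `ζ` rung
`weilPositivityOn_log_three_half` (kernel-checked certificate) gives `Re Q_ζ(g) ≥ 0`, the polar
bound `weilPolar_re_le` gives `2 Re(ĝ(0) conj ĝ(1)) ≤ 2(sinh a + a)‖g‖₂² = (2/√3 + log 3)‖g‖₂²` at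
`a = (log 3)/2` (`e^{a} = √3`), and `2/√3 + log 3 ≤ log 12 ≤ log q` because `2/√3 < 6/5` and
`e^{6/5} < 4` (`e⁶ < 1024`). The general statement `weilPositivityOnChar_of_even_of_trivial_at_two`
is the same transfer for any window `[-a, a]`, `2a ≤ log 3`, on which the `ζ` rung is known and
`2(sinh a + a) ≤ log q`.

## References

* A. Weil (1952), (11) and the «lemme» p. 262; H. Yoshida (1992), Thm 1 (the rung `(log 3)/2`).
-/

noncomputable section

open Complex Filter Set MeasureTheory
open scoped Real Topology ComplexConjugate ArithmeticFunction.vonMangoldt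

namespace Summit.Ventures.WeilGRH

open Literature.NumberTheory.LFunctions

variable {q : ℕ}

/-- If `χ(2) = 1` and `k` is continuous with `tsupport k ⊆ [-log 3, log 3]`, the twisted prime term
of `k` equals the `ζ` prime term: only `n = 2` contributes to either (`Λ(0) = Λ(1) = 0`,
`k(± log n) = 0` for `n ≥ 3`), and there `χ(2) = 1`. [cite: Weil1952FormulesExplicites, (11) pp. 261–262, prime term (case χ(𝔭) = 1)] -/
theorem weilPrimeTermChar_eq_weilPrimeTerm_of_trivial_at_two (χ : DirichletCharacter ℂ q)
    (h2 : χ (2 : ZMod q) = 1) {k : ℝ → ℂ} (hk : Continuous k)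
    (h : tsupport k ⊆ Icc (-Real.log 3) (Real.log 3)) :
    weilPrimeTermChar χ k = weilPrimeTerm k := by
  unfold weilPrimeTermChar weilPrimeTerm
  refine tsum_congr fun n ↦ ?_
  have hsupp := support_subset_Ioo_of_tsupport_subset_Icc hk h
  rcases Nat.lt_or_ge n 3 with hn | hn
  · interval_cases n
    · simp
    · simp
    · have h2' : χ ((2 : ℕ) : ZMod q) = 1 := by exact_mod_cast h2
      rw [h2', map_one, one_mul, one_mul]
  · have hlog : Real.log 3 ≤ Real.log n :=
      Real.log_le_log (by norm_num) (by exact_mod_cast hn)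
    have h1 : k (Real.log n) = 0 := by
      by_contra hne
      have := (hsupp hne).2
      linarith
    have h3 : k (-Real.log n) = 0 := by
      by_contra hne
      have := (hsupp hne).1
      linarith
    simp [h1, h3]

/-- **Transfer of a `ζ` rung to even characters trivial at `2`.** Let `0 ≤ a` with `2a ≤ log 3`
(so that `2` is the only prime power that can enter the window), `q ≠ 1`, and `χ` an even character
mod `q` with `χ(2) = 1`. If Weil positivity for `ζ` holds on `[-a, a]` and `2(sinh a + a) ≤ log q`,
then `WeilPositivityOnChar χ a`: indeed `Re Q_χ(g) = Re Q_ζ(g) - 2Re(ĝ(0)conj ĝ(1)) + (log q)‖g‖₂²`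
and `2Re(ĝ(0)conj ĝ(1)) ≤ 2(sinh a + a)‖g‖₂²` (`weilPolar_re_le`).
[cite: Weil1952FormulesExplicites, (11) and the «lemme» p. 262; Yoshida1992, §6 (6.2)] -/
theorem weilPositivityOnChar_of_even_of_trivial_at_two {a : ℝ} (ha : 2 * a ≤ Real.log 3)
    (hζ : WeilPositivityOn a) (hq1 : q ≠ 1) (hq : 2 * (Real.sinh a + a) ≤ Real.log q)
    (χ : DirichletCharacter ℂ q) (hχ : χ.Even) (h2 : χ (2 : ZMod q) = 1) :
    WeilPositivityOnChar χ a := by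
  intro g hg hsupp
  set k := weilConv g (weilReflect g) with hk
  have hkt : IsWeilTest k := hg.weilConv hg.weilReflect
  have hks : tsupport k ⊆ Icc (-Real.log 3) (Real.log 3) :=
    (tsupport_weilConv_weilReflect_subset hg.2 hsupp).trans (Icc_subset_Icc (by linarith) ha)
  set N : ℝ := ∫ t : ℝ, ‖g t‖ ^ 2 with hN
  set P : ℝ := 2 * (weilMellin g 0 * conj (weilMellin g 1)).re with hP
  -- the twisted functional versus the `ζ` functional: same prime term, no polar term, `+ log q · k(0)`
  have hQ : weilQuadraticChar χ g = weilQuadratic g - weilPolarTerm k + k 0 * (Real.log q : ℂ) := by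
    show weilFunctionalChar χ k = weilFunctional k - weilPolarTerm k + k 0 * (Real.log q : ℂ)
    unfold weilFunctionalChar weilFunctional weilArchTermChar weilArchTerm
    rw [if_neg hq1, charParity_of_even hχ, weilArchIntegralChar_zero,
      weilPrimeTermChar_eq_weilPrimeTerm_of_trivial_at_two χ h2 hkt.1.continuous hks]
    push_cast
    ring
  have hre : (weilQuadraticChar χ g).re =
      (weilQuadratic g).re - P + N * Real.log q := by
    rw [hQ, hk, weilPolarTerm_weilConv_weilReflect hg, weilConv_weilReflect_apply_zero, hP, hN]
    simp only [sub_re, add_re, Complex.ofReal_re, mul_re, Complex.ofReal_im, mul_zero,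
      sub_zero]
  have hζg : 0 ≤ (weilQuadratic g).re := hζ g hg hsupp
  have hPle : P ≤ 2 * (Real.sinh a + a) * N := weilPolar_re_le hg hsupp
  have hN0 : 0 ≤ N := integral_nonneg fun t ↦ by positivity
  rw [hre]
  nlinarith [mul_le_mul_of_nonneg_right hq hN0]

/-- `e^{(log 3)/2} = √3`, so `sinh((log 3)/2) = (√3 - 1/√3)/2 = 1/√3`. [folklore] -/
theorem sinh_log_three_half : Real.sinh (Real.log 3 / 2) = 1 / Real.sqrt 3 := by
  have h3 : Real.exp (Real.log 3 / 2) = Real.sqrt 3 := by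
    rw [Real.sqrt_eq_rpow, Real.rpow_def_of_pos (by norm_num : (0 : ℝ) < 3)]
    ring_nf
  have hs : Real.sqrt 3 ≠ 0 := by positivity
  have hsq : Real.sqrt 3 * Real.sqrt 3 = 3 := Real.mul_self_sqrt (by norm_num)
  rw [Real.sinh_eq, Real.exp_neg, h3]
  field_simp
  nlinarith [hsq]

/-- The numerical inequality for the rung `(log 3)/2`: `2(1/√3 + (log 3)/2) = 2/√3 + log 3 ≤ log 12`
(`2/√3 < 6/5` since `√3 > 5/3`; `e^{6/5} < 4` since `e⁶ < 1024`; `log 12 = log 3 + log 4`). [folklore] -/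
theorem two_div_sqrt_three_add_log_three_le_log_twelve :
    2 * (1 / Real.sqrt 3 + Real.log 3 / 2) ≤ Real.log 12 := by
  have hs3 : (5 / 3 : ℝ) < Real.sqrt 3 := by
    rw [show (5 / 3 : ℝ) = Real.sqrt ((5 / 3) ^ 2) by rw [Real.sqrt_sq (by norm_num)]]
    exact Real.sqrt_lt_sqrt (by norm_num) (by norm_num)
  have h1 : 2 * (1 / Real.sqrt 3) < 6 / 5 := by
    have h13 : 1 / Real.sqrt 3 < 3 / 5 := by
      rw [div_lt_iff₀ (by positivity)]
      nlinarith
    linarith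
  have he : Real.exp 1 < 2.7182818286 := Real.exp_one_lt_d9
  have he6 : Real.exp 6 < 1024 := by
    have h6 : Real.exp 6 = Real.exp 1 ^ 6 := by rw [← Real.exp_nat_mul]; norm_num
    rw [h6]
    have hp : Real.exp 1 ^ 6 < (2.7182818286 : ℝ) ^ 6 :=
      pow_lt_pow_left₀ he (Real.exp_pos 1).le (by norm_num)
    have hn : (2.7182818286 : ℝ) ^ 6 < 1024 := by norm_num
    linarith
  have h65 : Real.exp (6 / 5) < 4 := by
    have hsq : Real.exp (6 / 5) ^ 5 = Real.exp 6 := by rw [← Real.exp_nat_mul]; norm_num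
    have hlt : Real.exp (6 / 5) ^ 5 < (4 : ℝ) ^ 5 := by rw [hsq]; norm_num; linarith
    exact lt_of_pow_lt_pow_left₀ 5 (by norm_num) hlt
  have h4 : (6 / 5 : ℝ) < Real.log 4 := by
    rw [Real.lt_log_iff_exp_lt (by norm_num)]
    exact h65
  have h12 : Real.log 12 = Real.log 3 + Real.log 4 := by
    rw [← Real.log_mul (by norm_num) (by norm_num)]; norm_num
  rw [h12]
  linarith

/-- **The `ζ` base rung `(log 3)/2` holds for every even character trivial at `2`, `q ≥ 12`:**
`WeilPositivityOnChar χ ((log 3)/2)` for `χ` even mod `q ≥ 12` with `χ(2) = 1` (e.g. the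
Kronecker symbol `(17/·)`, Conrey `17.16`). Transfer of Yoshida's rung
`weilPositivityOn_log_three_half` (kernel-checked certificate in the tree).
[cite: Weil1952FormulesExplicites, (11) and the «lemme» p. 262; Yoshida1992, Thm 1 (p. 310)] -/
theorem weilPositivityOnChar_log_three_half_of_even_of_trivial_at_two (hq : 12 ≤ q)
    (χ : DirichletCharacter ℂ q) (hχ : χ.Even) (h2 : χ (2 : ZMod q) = 1) :
    WeilPositivityOnChar χ (Real.log 3 / 2) := by
  have hq1 : q ≠ 1 := by omega
  refine weilPositivityOnChar_of_even_of_trivial_at_two (by linarith) weilPositivityOn_log_three_half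
    hq1 ?_ χ hχ h2
  have hlogq : Real.log 12 ≤ Real.log q :=
    Real.log_le_log (by norm_num) (by exact_mod_cast hq)
  rw [sinh_log_three_half]
  linarith [two_div_sqrt_three_add_log_three_le_log_twelve]

end Summit.Ventures.WeilGRH
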